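import Literature.Geometry.GaugeTheory.InstantonEntropy
import Literature.Topology.FourManifolds.HomotopySpheres
import Mathlib.Geometry.Manifold.MFDeriv.NormedSpace
import HarnessLib

/-!
# The collar of the charge-one instanton moduli space of a homotopy 4-sphere and the
# asymptotics of the information metric along it

Topic `Literature/Geometry/GaugeTheory` (companion of `AsdModuliSpace.lean`, `InstantonEntropy.lean`).

One cited fact, `informationMetric_collarAsymptotics`: the special case `H²(M) = 0` (a homotopy
4-sphere) of Groisser–Murray 1997, Theorem 3.1 — the information metric
`𝐠(X, X) = ∫ (∂_X ρ)² / ρ dvol` of the curvature densities `ρ_[A] = |F_A|²_g` is `C⁰`-asymptotic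
to the cone ("asymptotically hyperbolic") metric `c (dλ² + g)/λ²` along the Donaldson–Taubes
collar `Ψ : Σ × (0, λ₀) → M₁(Σ, g)` of the charge-one moduli space — packaged together with the
collar structure on which the theorem is stated (Groisser–Murray 1997, §3, p. 6, quoting Donaldson
1983 and Freed–Uhlenbeck 1984: "there is a compact set in `M₁` whose complement — the collar —
consists of instantons with curvature concentrated near a point, and is diffeomorphic to
(open interval) × M via the map assigning to each sufficiently concentrated connection a scale
`λ(A)` and center point"; compactness of the complement of the far collar is Uhlenbeck's
compactness theorem at charge one on a simply connected base). Everything is phrased over the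
tree's carrier `AsdModuliSpace g Σ.orientation 1` (quotient `C^∞` topology) and its
`AsdModuliSpace.density`, with the collar parametrised by the product manifold `Σ × ℝ`
(meaningful on `Σ × (0, λ₀)`), so that no smooth structure on the moduli space is presupposed:
smoothness enters only through the joint smoothness of the densities along the collar.

Nothing is proved here (a `def … : Prop`; users take `(h : informationMetric_collarAsymptotics)`).

## References

* [GroisserMurray1997] D. Groisser, M. K. Murray, *Instantons and the information metric*,
  Ann. Global Anal. Geom. 15 (1997) 519–537 (dg-ga/9611008), §2 (metric1), §3 Conditions 3.0,
  Theorem 3.1 and its proof pp. 6–8.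
* [Donaldson1983] S. K. Donaldson, *An application of gauge theory to four-dimensional
  topology*, J. Differential Geom. 18 (1983) 279–315, §§III–IV (the collar / ends of `M₁`).
* [FreedUhlenbeck1984] D. Freed, K. Uhlenbeck, *Instantons and Four-Manifolds* (1984),
  Chs. 8–9 (Taubes' existence theorem; the collar theorem).
* [DonaldsonKronheimer1990] S. K. Donaldson, P. B. Kronheimer, *The Geometry of
  Four-Manifolds* (1990), §4.4 (Uhlenbeck compactness), §§7.2–7.3, 8.3 (the ends of `M₁` for a
  definite form).
* [GroisserParker1987] D. Groisser, T. Parker, *The Riemannian geometry of the Yang–Mills moduli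
  space*, Comm. Math. Phys. 112 (1987) 663–689 (smooth scale and centre on the collar).
-/

noncomputable section

open scoped Manifold ContDiff Topology
open Set Function MeasureTheory
open Literature.Geometry.Lorentzian (PseudoRiemannianMetric)
open Literature.Topology.FourManifolds (HomotopySphere)

namespace Literature.Geometry.GaugeTheory

/-- **The Donaldson–Taubes collar of `M₁(Σ, g)` for a homotopy 4-sphere and the Groisser–Murray
asymptotics of the information metric along it.** Let `Σ` be a (smooth, oriented, closed) homotopy
4-sphere with a Riemannian metric `g` for which every irreducible `g`-anti-self-dual connection on
`P₁` is regular (`IsFreedUhlenbeckGeneric g Σ.orientation 1` — Groisser–Murray's standing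
assumption, §2 p. 4: the deformation complex is right-exact at every instanton, a property of
generic metrics, Freed–Uhlenbeck 1984 Ch. 3). Then there are `λ₀ > 0`, `c > 0` and a map
`Ψ : Σ × ℝ → M₁(Σ, g) = AsdModuliSpace g Σ.orientation 1` (centre × scale ↦ concentrated
instanton; meaningful on `Σ × (0, λ₀)`) such that:
* `Ψ` is continuous and injective on `Σ × (0, λ₀)` (it is a diffeomorphism onto the open collar
  `M₁^{λ₀}`; GM §3 p. 6 after Donaldson 1983 §§III–IV, Freed–Uhlenbeck 1984 Ch. 9);
* the far parts `Ψ(Σ × (0, t))`, `0 < t < λ₀`, have compact complement in `M₁` (Uhlenbeck 1982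
  compactness at charge one on a simply connected base — the only ideal points are concentrated
  ones — and surjectivity of the collar map onto the concentrated classes; DK 1990 §4.4, §8.3), and
  `closure Ψ(Σ × (0, s)) ⊆ Ψ(Σ × (0, t))` for `s < t` (the scale extends continuously by `0` to
  the Uhlenbeck compactification, in which `Ψ(Σ × [0, s])` is compact);
* the curvature densities `ρ_{Ψ(σ, λ)}(x) = |F|²_g(x)` (`AsdModuliSpace.density`, gauge
  invariant) depend smoothly on `((σ, λ), x) ∈ (Σ × (0, λ₀)) × Σ` and concentrate:
  `sup_x ρ_{Ψ(σ,λ)}(x) → ∞` uniformly as `λ → 0` (it is `≍ λ⁻⁴`);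
* (GM Thm. 3.1) the information metric `𝐠(X, X) = ∫_Σ (∂_X ρ)² / ρ dvol_g` of the family along the
  collar (GM (metric1): `∫ (∂e/∂η / e)² e`; the integrand vanishes where `ρ = 0`, where also
  `∂_X ρ = 0`) is `C⁰`-asymptotic to `c (dλ² + g)/λ²`: for every `ε > 0` there is `t > 0` such
  that `|𝐠(X, X) − c (s² + g(v, v))/λ²| ≤ ε · c (s² + g(v, v))/λ²` for every tangent vector
  `X = (v, s)` at every point `(σ, λ)` with `0 < λ < t` (`c = 128π²/5` for GM's normalisation of
  `|F|²`; here `∃ c > 0`).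
-- TODO(general form): Groisser–Murray prove Thm. 3.1 for every closed simply connected oriented
-- `M` with positive-definite intersection form and instanton number one (their Conditions 3.0),
-- with `g_M` on the cross-section; stated here for `H²(M) = 0` only, over the tree's `M₁`.
[cite: GroisserMurray1997, Thm. 3.1, §3 pp. 6–8 and §2 (metric1)] -/
def informationMetric_collarAsymptotics : Prop :=
  ∀ (S : HomotopySphere 4) [Nonempty S.carrier]
    (g : PseudoRiemannianMetric (𝓡 4) ∞ (EuclideanSpace ℝ (Fin 4)) (TangentSpace (𝓡 4) : S.carrier → Type _))
    (hg : g.IsRiemannian), IsFreedUhlenbeckGeneric g S.orientation 1 →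
    ∃ (l₀ c : ℝ) (Ψ : S.carrier × ℝ → AsdModuliSpace g S.orientation 1), 0 < l₀ ∧ 0 < c ∧
      ContinuousOn Ψ (univ ×ˢ Ioo 0 l₀) ∧ InjOn Ψ (univ ×ˢ Ioo 0 l₀) ∧
      (∀ t ∈ Ioo 0 l₀, IsCompact (Ψ '' (univ ×ˢ Ioo 0 t))ᶜ) ∧
      (∀ s t : ℝ, 0 < s → s < t → t < l₀ →
        closure (Ψ '' (univ ×ˢ Ioo 0 s)) ⊆ Ψ '' (univ ×ˢ Ioo 0 t)) ∧
      ContMDiffOn (((𝓡 4).prod 𝓘(ℝ, ℝ)).prod (𝓡 4)) 𝓘(ℝ, ℝ) ∞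
        (fun q : (S.carrier × ℝ) × S.carrier ↦ (Ψ q.1).density g q.2)
        ((univ ×ˢ Ioo 0 l₀) ×ˢ univ) ∧
      (∀ R : ℝ, ∃ t ∈ Ioo 0 l₀, ∀ p ∈ (univ : Set S.carrier) ×ˢ Ioo 0 t,
        ∃ x, R ≤ (Ψ p).density g x) ∧
      (∀ ε : ℝ, 0 < ε → ∃ t ∈ Ioo 0 l₀, ∀ (σ : S.carrier) (l : ℝ), l ∈ Ioo 0 t →
        ∀ (v : TangentSpace (𝓡 4) σ) (s : ℝ),
          |(∫ x, (mvfderiv ((𝓡 4).prod 𝓘(ℝ, ℝ))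
                    (fun p : S.carrier × ℝ ↦ (Ψ p).density g x) (σ, l) (v, s)) ^ 2 /
                  (Ψ (σ, l)).density g x ∂(volMeasure g hg)) -
              c * (s ^ 2 + g.val σ v v) / l ^ 2|
            ≤ ε * (c * (s ^ 2 + g.val σ v v) / l ^ 2))

end Literature.Geometry.GaugeTheory

end
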